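import Mathlib.LinearAlgebra.Matrix.Kronecker
import Mathlib.LinearAlgebra.Matrix.ToLin
import Literature.Computability.AlgebraicComplexity.KoszulFlatteningBorderRank
import Literature.Computability.AlgebraicComplexity.BorderRankRestriction
import Literature.Computability.AlgebraicComplexity.FlatteningRank
import Literature.Computability.AlgebraicComplexity.OuterProductRank
import HarnessLib

/-!
# Propagation of Koszul-flattening bounds under Kronecker products (CGLV 2022, Prop. 3.2) — proved

Topic: `Literature/Computability/AlgebraicComplexity`. Support for the fact item on
`CGLV2022_thm12_power` (`BorderRankCW.lean`): §3.2 of Conner–Gesmundo–Landsberg–Ventura, *Rank and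
border rank of Kronecker powers of tensors and Strassen's laser method*, comput. complexity 31
(2022), arXiv:1909.04785v2, on top of the tree's coordinate Koszul flattening
`koszulFlattening p Φ t` (`MatMulRankLowerBoundsProofs.lean`), its BORDER-rank bound
`rank K_M(t) ≤ binom(2p,p) · bR(t)` (`KoszulFlatteningBorderRank.lean`, CGLV §3 eq. (8)), the
algebraic border rank `algBorderRank` (`SchoenhageTau.lean`, Bläser 2013 Def. 6.1) with its
relabelling calculus (`BorderRankRestriction.lean`), and `kroneckerTensor` / `kroneckerPow`
(`AsymptoticSpectrum.lean`).  Everything in this file is PROVED; there are no named facts.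

## Content (CGLV numbering of arXiv v2 = journal version)

* `rank_koszulFlattening_linearMap_le_choose_mul_algBorderRank` — the tree's bound for an arbitrary
  linear `Φ : K^ι → K^{2p+1}` (one line from the matrix form).
* `contractFirst α t = T(α) ∈ B ⊗ C` (a `κ × μ` matrix); `IsOneAGeneric` (§3.2: `dim B = dim C` and
  `T(A^*)` contains a full-rank element).
* `tensorCovector Φ α = Φ ⊗ α : A₁ ⊗ A₂ → A'`, `koszulFlattening_tensorCovector_reindex`
  (`K_{Φ⊗α}(T₁ ⊠ T₂) = K_Φ(T₁) ⊗ T₂(α)ᵀ` as a Kronecker product of matrices),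
  `matRank_kroneckerMap_mul` (`rank(A ⊗ B) = rank A · rank B`, from
  `OuterProductRank.finrank_span_outerFun` of `OuterProductRank.lean`; Mathlib has no
  `rank_kronecker` at this pin), and **Prop. 3.2** `CGLV2022_prop32` :
  `rank K_Φ(T₁) · rank T₂(α) ≤ binom(2p,p) · bR(T₁ ⊠ T₂)` for every covector `α` on `A₂`;
  `CGLV2022_prop32_of_isOneAGeneric` : `rank K_Φ(T₁) · b₂ ≤ binom(2p,p) · bR(T₁ ⊠ T₂)`.
* `kroneckerPow_add_reindex`, `algBorderRank_kroneckerPow_add` (`t^{⊠(M+N)} ≅ t^{⊠M} ⊠ t^{⊠N}`),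
  `powCovector`, `powMatrix` (+ `_mul`, `_one`, `isUnit_powMatrix`), `isOneAGeneric_kroneckerPow`
  (powers of a tensor with an invertible `t(α)` are `1_A`-generic — the remark
  "`T_{cw,q}^{⊠(N-3)}` is `1_A`-generic" in the proof of Cor. 3.5) and
  `rank_koszulFlattening_mul_pow_le_algBorderRank_kroneckerPow` :
  `rank K_Φ(t^{⊠M}) · (dim B)^N ≤ binom(2p,p) · bR(t^{⊠L})`, `L = M + N`.

## Design choices and wording risks

* Prop. 3.2 is kept in product form over `ℕ` (`rank · rank T₂(α) ≤ binom(2p,p) · bR`), equivalent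
  to the printed ceiling form `bR(T₁ ⊠ T₂) ≥ ⌈rank(T₁^{∧p}_{A'}) b₂ / binom(2p,p)⌉` because
  `bR ∈ ℕ`; the covector `α` is arbitrary and `dim B₁ = dim C₁` is not needed (harmless
  generalisations, proved); the printed hypothesis "`T₂` `1_{A₂}`-generic, `dim B₂ = dim C₂ = b₂`"
  is the case `rank T₂(α) = b₂` (`CGLV2022_prop32_of_isOneAGeneric`).  The restriction
  `φ : A₁ → A'` of the source is the `Φ` built into `koszulFlattening`.  Proof as printed: the
  flattening of `(Id ⊗ α)(T₁ ⊠ T₂)` "coincides with `T₁^{∧p} ⊠ T₂(α)`" and matrix rank is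
  multiplicative under Kronecker products.
* `IsOneAGeneric` is stated over a field and records `dim B = dim C` inside the predicate (the
  source defines the notion only in that case).
* `rank_koszulFlattening_mul_pow_le_algBorderRank_kroneckerPow` takes `L = M + N` as a hypothesis
  to avoid transporting along `t^{⊠(M+N)} = t^{⊠L}`.

## References

* A. Conner, F. Gesmundo, J. M. Landsberg, E. Ventura, *Rank and border rank of Kronecker powers of
  tensors and Strassen's laser method*, comput. complexity 31 (2022): §3 eq. (8) (p. 9), §3.2 and
  Prop. 3.2 (p. 10), proof of Cor. 3.5 (p. 17), doi:10.1007/s00037-021-00217-y, arXiv:1909.04785v2.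
  [ConnerGesmundoLandsbergVentura2022]
* M. Bläser, *Fast Matrix Multiplication*, Theory of Computing Graduate Surveys 5 (2013), Def. 6.1.
  [Blaser2013]
-/

noncomputable section

open scoped BigOperators Polynomial
open Module Submodule

namespace Literature.Computability.AlgebraicComplexity

/-! ## The Koszul border-rank bound for an arbitrary linear `Φ : A → A'` -/

section LinearForm

variable {K : Type*} [Field K] {ι κ μ : Type*}

/-- The tree's border-rank Koszul bound (`rank_koszulFlattening_le_choose_mul_algBorderRank`, stated
for `Φ = M.mulVecLin`) for an arbitrary linear map `Φ : K^ι → K^{2p+1}`: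
`rank K_Φ(t) ≤ binom(2p, p) · bR(t)` (CGLV 2022, §3, eq. (8)). [cite: ConnerGesmundoLandsbergVentura2022, §3 eq. (8)] -/
theorem rank_koszulFlattening_linearMap_le_choose_mul_algBorderRank [Fintype ι] [DecidableEq ι]
    [Fintype κ] [DecidableEq κ] [Fintype μ] [DecidableEq μ] (p : ℕ)
    (Φ : (ι → K) →ₗ[K] (Fin (2 * p + 1) → K)) (t : ι → κ → μ → K) :
    (koszulFlattening p Φ t).rank ≤ (2 * p).choose p * algBorderRank t := by
  have h := rank_koszulFlattening_le_choose_mul_algBorderRank p (LinearMap.toMatrix' Φ) t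
  rwa [← Matrix.toLin'_apply', Matrix.toLin'_toMatrix'] at h

end LinearForm

/-! ## Contraction with a covector; `1_A`-genericity -/

section Functorial

variable {K : Type*} [CommSemiring K] {ι ι' κ κ' μ μ' : Type*}

/-- The contraction `T(α) = ∑_a α_a t_{a··} ∈ B ⊗ C` of the first factor with a covector `α`, as a
`κ × μ` matrix (CGLV 2022, §3.2: the elements of `T(A^*) ⊆ B ⊗ C`). [cite: ConnerGesmundoLandsbergVentura2022, §3.2 (p. 10)] -/
def contractFirst [Fintype ι] (α : ι → K) (t : ι → κ → μ → K) : Matrix κ μ K :=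
  Matrix.of fun b c => ∑ i, α i * t i b c

/-- Entries of `T(α)`. [cite: ConnerGesmundoLandsbergVentura2022, §3.2 (p. 10)] -/
@[simp] theorem contractFirst_apply [Fintype ι] (α : ι → K) (t : ι → κ → μ → K) (b : κ) (c : μ) :
    contractFirst α t b c = ∑ i, α i * t i b c := rfl

end Functorial

/-- **`1_A`-genericity** (CGLV 2022, §3.2): `T ∈ A ⊗ B ⊗ C` with `dim B = dim C` is `1_A`-generic if
`T(A^*) ⊆ B ⊗ C` contains an element of full rank. [cite: ConnerGesmundoLandsbergVentura2022, §3.2 (p. 10)] -/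
def IsOneAGeneric {K : Type*} [Field K] {ι κ μ : Type*} [Fintype ι] [Fintype κ] [Fintype μ]
    (t : ι → κ → μ → K) : Prop :=
  Fintype.card κ = Fintype.card μ ∧ ∃ α : ι → K, (contractFirst α t).rank = Fintype.card κ

/-! ## Propagation under Kronecker products (CGLV 2022, Prop. 3.2) -/

section Propagation

variable {K : Type*} [CommRing K] {ι₁ κ₁ μ₁ ι₂ κ₂ μ₂ : Type*}

/-- The linear map `Φ ⊗ α : A₁ ⊗ A₂ → A'` (`Ψ ∘ (φ ⊗ Id)` in the proof of CGLV Prop. 3.2):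
`f ↦ Φ(a ↦ ∑_{i} α_i f(a, i))`. [cite: ConnerGesmundoLandsbergVentura2022, Prop. 3.2 (proof)] -/
def tensorCovector [Fintype ι₁] [DecidableEq ι₁] [Fintype ι₂] [DecidableEq ι₂] {p : ℕ}
    (Φ : (ι₁ → K) →ₗ[K] (Fin (2 * p + 1) → K)) (α : ι₂ → K) :
    (ι₁ × ι₂ → K) →ₗ[K] (Fin (2 * p + 1) → K) :=
  Φ ∘ₗ Matrix.toLin' (Matrix.of fun (a : ι₁) (x : ι₁ × ι₂) => if x.1 = a then α x.2 else 0)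

/-- `(Φ ⊗ α)` applied to a slice of `T₁ ⊠ T₂` is `T₂(α)_{b₂c₂} · Φ(T₁(·, b₁, c₁))`.
[cite: ConnerGesmundoLandsbergVentura2022, Prop. 3.2 (proof)] -/
theorem tensorCovector_kroneckerTensor_slice [Fintype ι₁] [DecidableEq ι₁] [Fintype ι₂]
    [DecidableEq ι₂] {p : ℕ} (Φ : (ι₁ → K) →ₗ[K] (Fin (2 * p + 1) → K)) (α : ι₂ → K)
    (T₁ : ι₁ → κ₁ → μ₁ → K) (T₂ : ι₂ → κ₂ → μ₂ → K) (b : κ₁ × κ₂) (c : μ₁ × μ₂) :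
    tensorCovector Φ α (fun x => kroneckerTensor T₁ T₂ x b c) =
      contractFirst α T₂ b.2 c.2 • Φ (fun a => T₁ a b.1 c.1) := by
  have key : Matrix.toLin' (Matrix.of fun (a : ι₁) (x : ι₁ × ι₂) => if x.1 = a then α x.2 else 0)
      (fun x => kroneckerTensor T₁ T₂ x b c) = contractFirst α T₂ b.2 c.2 • fun a => T₁ a b.1 c.1 := by
    funext a
    simp only [Matrix.toLin'_apply, Matrix.mulVec, dotProduct, Matrix.of_apply,
      kroneckerTensor_apply, Pi.smul_apply, smul_eq_mul, contractFirst_apply]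
    rw [Fintype.sum_prod_type, Finset.sum_eq_single a]
    · simp only [if_true, Finset.sum_mul]
      exact Finset.sum_congr rfl fun i _ => by ring
    · intro a' _ ha'
      simp [ha']
    · intro h
      exact absurd (Finset.mem_univ _) h
  rw [tensorCovector, LinearMap.comp_apply, key, map_smul]

/-- The Koszul flattening of `T₁ ⊠ T₂` after `Φ ⊗ α` is the Kronecker product of matrices
`K_Φ(T₁) ⊗ T₂(α)ᵀ` (CGLV 2022, proof of Prop. 3.2: "coincides with `T₁^{∧p}_{A'} ⊠ T₂(α)`").
[cite: ConnerGesmundoLandsbergVentura2022, Prop. 3.2 (proof)] -/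
theorem koszulFlattening_tensorCovector_reindex [Fintype ι₁] [DecidableEq ι₁] [Fintype ι₂]
    [DecidableEq ι₂] (p : ℕ) (Φ : (ι₁ → K) →ₗ[K] (Fin (2 * p + 1) → K)) (α : ι₂ → K)
    (T₁ : ι₁ → κ₁ → μ₁ → K) (T₂ : ι₂ → κ₂ → μ₂ → K) :
    (koszulFlattening p (tensorCovector Φ α) (kroneckerTensor T₁ T₂)).reindex
        (Equiv.prodAssoc _ _ _).symm (Equiv.prodAssoc _ _ _).symm =
      Matrix.kroneckerMap (· * ·) (koszulFlattening p Φ T₁) (contractFirst α T₂).transpose := by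
  ext ⟨⟨S, c⟩, c'⟩ ⟨⟨R, b⟩, b'⟩
  simp only [Matrix.reindex_apply, Matrix.submatrix_apply, Equiv.symm_symm, Equiv.prodAssoc_apply,
    koszulFlattening_apply, Matrix.kroneckerMap_apply, Matrix.transpose_apply]
  rw [tensorCovector_kroneckerTensor_slice, wedgeMatrix_smul, Matrix.smul_apply, smul_eq_mul,
    mul_comm]

/-- `rank (A ⊗ B) = rank A · rank B` for the Kronecker product of matrices over a field. [folklore] -/
theorem matRank_kroneckerMap_mul {L : Type*} [Field L] {m₁ n₁ m₂ n₂ : Type*} [Fintype m₁]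
    [Fintype n₁] [Fintype m₂] [Fintype n₂] [DecidableEq n₁] [DecidableEq n₂] (A : Matrix m₁ n₁ L)
    (B : Matrix m₂ n₂ L) : (Matrix.kroneckerMap (· * ·) A B).rank = A.rank * B.rank := by
  rw [Matrix.rank_eq_finrank_span_cols, Matrix.rank_eq_finrank_span_cols,
    Matrix.rank_eq_finrank_span_cols]
  have hcol : (Matrix.kroneckerMap (· * ·) A B).col =
      fun kk : n₁ × n₂ => OuterProductRank.outerFun (A.col kk.1) (B.col kk.2) := by
    funext kk ij; rfl
  rw [hcol, OuterProductRank.finrank_span_outerFun]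

/-- **CGLV 2022, Prop. 3.2**: for `T₁ ∈ A₁ ⊗ B₁ ⊗ C₁`, a linear `Φ : A₁ → A' = K^{2p+1}`,
`T₂ ∈ A₂ ⊗ B₂ ⊗ C₂` and every covector `α` on `A₂`,
`rank((ΦT₁)^{∧p}_{A'}) · rank T₂(α) ≤ binom(2p, p) · bR(T₁ ⊠ T₂)`; with `T₂` `1_{A₂}`-generic
(`rank T₂(α) = b₂`) this is the printed `bR(T₁ ⊠ T₂) ≥ ⌈rank((T₁)^{∧p}_{A'}) · b₂ / binom(2p,p)⌉`.
Proof as printed: the flattening of `(Φ ⊗ α)(T₁ ⊠ T₂)` is `T₁^{∧p} ⊗ T₂(α)ᵀ` and matrix rank is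
multiplicative under Kronecker products. [cite: ConnerGesmundoLandsbergVentura2022, Prop. 3.2] -/
theorem CGLV2022_prop32 {K : Type*} [Field K] {ι₁ κ₁ μ₁ ι₂ κ₂ μ₂ : Type*} [Fintype ι₁] [Fintype κ₁]
    [Fintype μ₁] [Fintype ι₂] [Fintype κ₂] [Fintype μ₂] [DecidableEq ι₁] [DecidableEq κ₁]
    [DecidableEq μ₁] [DecidableEq ι₂] [DecidableEq κ₂] [DecidableEq μ₂] (p : ℕ)
    (Φ : (ι₁ → K) →ₗ[K] (Fin (2 * p + 1) → K)) (T₁ : ι₁ → κ₁ → μ₁ → K) (T₂ : ι₂ → κ₂ → μ₂ → K)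
    (α : ι₂ → K) :
    (koszulFlattening p Φ T₁).rank * (contractFirst α T₂).rank ≤
      (2 * p).choose p * algBorderRank (kroneckerTensor T₁ T₂) := by
  classical
  have h1 := rank_koszulFlattening_linearMap_le_choose_mul_algBorderRank p (tensorCovector Φ α)
    (kroneckerTensor T₁ T₂)
  rwa [← Matrix.rank_reindex (Equiv.prodAssoc _ _ _).symm (Equiv.prodAssoc _ _ _).symm,
    koszulFlattening_tensorCovector_reindex, matRank_kroneckerMap_mul, Matrix.rank_transpose] at h1

/-- **CGLV 2022, Prop. 3.2, `1_{A₂}`-generic form**: `rank((ΦT₁)^{∧p}_{A'}) · b₂ ≤ binom(2p,p) · bR(T₁ ⊠ T₂)`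
with `b₂ = dim B₂ = dim C₂`, i.e. `bR(T₁ ⊠ T₂) ≥ ⌈rank((T₁)^{∧p}_{A'}) b₂ / binom(2p, p)⌉`.
[cite: ConnerGesmundoLandsbergVentura2022, Prop. 3.2] -/
theorem CGLV2022_prop32_of_isOneAGeneric {K : Type*} [Field K] {ι₁ κ₁ μ₁ ι₂ κ₂ μ₂ : Type*}
    [Fintype ι₁] [Fintype κ₁] [Fintype μ₁] [Fintype ι₂] [Fintype κ₂] [Fintype μ₂] [DecidableEq ι₁]
    [DecidableEq κ₁] [DecidableEq μ₁] [DecidableEq ι₂] [DecidableEq κ₂] [DecidableEq μ₂] (p : ℕ)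
    (Φ : (ι₁ → K) →ₗ[K] (Fin (2 * p + 1) → K)) (T₁ : ι₁ → κ₁ → μ₁ → K) {T₂ : ι₂ → κ₂ → μ₂ → K}
    (hT₂ : IsOneAGeneric T₂) :
    (koszulFlattening p Φ T₁).rank * Fintype.card κ₂ ≤
      (2 * p).choose p * algBorderRank (kroneckerTensor T₁ T₂) := by
  obtain ⟨-, α, hα⟩ := hT₂
  rw [← hα]
  exact CGLV2022_prop32 p Φ T₁ T₂ α

end Propagation

/-! ## Kronecker powers: `t^{⊠(M+N)} ≅ t^{⊠M} ⊠ t^{⊠N}` and `1_A`-genericity of powers -/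

section Powers

variable {K : Type*} [CommRing K] {ι κ μ : Type*}

/-- `t^{⊠(M+N)} ≅ t^{⊠M} ⊠ t^{⊠N}` along `Fin.appendEquiv` on each index set. [folklore] -/
theorem kroneckerPow_add_reindex (t : ι → κ → μ → K) (M N : ℕ) :
    (fun a b c => kroneckerPow t (M + N) (Fin.appendEquiv M N a) (Fin.appendEquiv M N b)
        (Fin.appendEquiv M N c)) =
      kroneckerTensor (kroneckerPow t M) (kroneckerPow t N) := by
  funext a b c
  simp only [kroneckerPow_apply, kroneckerTensor_apply, Fin.appendEquiv_apply, Fin.prod_univ_add,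
    Fin.append_left, Fin.append_right]

/-- `bR(t^{⊠(M+N)}) = bR(t^{⊠M} ⊠ t^{⊠N})`. [folklore] -/
theorem algBorderRank_kroneckerPow_add [Fintype ι] [Fintype κ] [Fintype μ] [DecidableEq ι]
    [DecidableEq κ] [DecidableEq μ] (t : ι → κ → μ → K) (M N : ℕ) :
    algBorderRank (kroneckerPow t (M + N)) =
      algBorderRank (kroneckerTensor (kroneckerPow t M) (kroneckerPow t N)) := by
  rw [← kroneckerPow_add_reindex, algBorderRank_reindex]

/-- The covector `α^{⊗N}` on `A^{⊗N}`. [folklore] -/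
def powCovector (α : ι → K) (N : ℕ) : (Fin N → ι) → K := fun a => ∏ l, α (a l)

/-- The Kronecker power `B^{⊗N}` of a matrix. [folklore] -/
def powMatrix (B : Matrix κ μ K) (N : ℕ) : Matrix (Fin N → κ) (Fin N → μ) K :=
  Matrix.of fun b c => ∏ l, B (b l) (c l)

/-- Entries of `B^{⊗N}`. [folklore] -/
theorem powMatrix_apply (B : Matrix κ μ K) (N : ℕ) (b : Fin N → κ) (c : Fin N → μ) :
    powMatrix B N b c = ∏ l, B (b l) (c l) := rfl

/-- `t^{⊠N}(α^{⊗N}) = (t(α))^{⊗N}`. [folklore] -/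
theorem contractFirst_powCovector_kroneckerPow [Fintype ι] [DecidableEq ι] (α : ι → K)
    (t : ι → κ → μ → K) (N : ℕ) :
    contractFirst (powCovector α N) (kroneckerPow t N) = powMatrix (contractFirst α t) N := by
  ext b c
  simp only [contractFirst_apply, powCovector, kroneckerPow_apply, powMatrix_apply,
    ← Finset.prod_mul_distrib]
  rw [Finset.prod_univ_sum (fun _ => Finset.univ) (fun l i => α i * t i (b l) (c l)),
    Fintype.piFinset_univ]

/-- `B^{⊗N} B'^{⊗N} = (B B')^{⊗N}`. [folklore] -/
theorem powMatrix_mul [Fintype μ] [DecidableEq μ] {ν : Type*} (B : Matrix κ μ K) (B' : Matrix μ ν K)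
    (N : ℕ) : powMatrix B N * powMatrix B' N = powMatrix (B * B') N := by
  ext b c
  simp only [Matrix.mul_apply, powMatrix_apply, ← Finset.prod_mul_distrib]
  rw [Finset.prod_univ_sum (fun _ => Finset.univ) (fun l j => B (b l) j * B' j (c l)),
    Fintype.piFinset_univ]

/-- `1^{⊗N} = 1`. [folklore] -/
theorem powMatrix_one [DecidableEq κ] (N : ℕ) : powMatrix (1 : Matrix κ κ K) N = 1 := by
  ext b c
  simp only [powMatrix_apply, Matrix.one_apply]
  rw [Fintype.prod_boole]
  simp [funext_iff]

/-- Kronecker powers of invertible matrices are invertible. [folklore] -/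
theorem isUnit_powMatrix [Fintype κ] [DecidableEq κ] {B : Matrix κ κ K} (hB : IsUnit B) (N : ℕ) :
    IsUnit (powMatrix B N) := by
  obtain ⟨B', h1, h2⟩ := isUnit_iff_exists.1 hB
  exact isUnit_iff_exists.2 ⟨powMatrix B' N, by rw [powMatrix_mul, h1, powMatrix_one],
    by rw [powMatrix_mul, h2, powMatrix_one]⟩

/-- **Kronecker powers of a tensor with an invertible `t(α)` are `1_A`-generic** (CGLV 2022,
proof of Cor. 3.5: "`T_2 = T_{cw,q}^{⊠ N-3}` is `1_A`-generic"; witnessed by `α^{⊗N}`).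
[cite: ConnerGesmundoLandsbergVentura2022, Cor. 3.5 (proof)] -/
theorem isOneAGeneric_kroneckerPow {K : Type*} [Field K] [Fintype ι] [DecidableEq ι] [Fintype κ]
    [DecidableEq κ] (t : ι → κ → κ → K) {α : ι → K} (hα : IsUnit (contractFirst α t)) (N : ℕ) :
    IsOneAGeneric (kroneckerPow t N) := by
  refine ⟨rfl, powCovector α N, ?_⟩
  rw [contractFirst_powCovector_kroneckerPow]
  exact Matrix.rank_of_isUnit _ (isUnit_powMatrix hα N)

/-- **Propagation to Kronecker powers** (CGLV 2022, Prop. 3.2 as used in the proof of Cor. 3.5):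
if `t(α)` is invertible then for every linear `Φ : A^{⊗M} → K^{2p+1}`,
`rank((Φ t^{⊠M})^{∧p}) · (dim B)^N ≤ binom(2p,p) · bR(t^{⊠L})`, `L = M + N`.
[cite: ConnerGesmundoLandsbergVentura2022, Cor. 3.5 (proof)] -/
theorem rank_koszulFlattening_mul_pow_le_algBorderRank_kroneckerPow {K : Type*} [Field K]
    [Fintype ι] [DecidableEq ι] [Fintype κ] [DecidableEq κ] (t : ι → κ → κ → K) {α : ι → K}
    (hα : IsUnit (contractFirst α t)) (p M N L : ℕ) (hL : M + N = L)
    (Φ : ((Fin M → ι) → K) →ₗ[K] (Fin (2 * p + 1) → K)) :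
    (koszulFlattening p Φ (kroneckerPow t M)).rank * Fintype.card κ ^ N ≤
      (2 * p).choose p * algBorderRank (kroneckerPow t L) := by
  classical
  subst hL
  rw [algBorderRank_kroneckerPow_add, ← Fintype.card_fin N, ← Fintype.card_fun, Fintype.card_fin]
  exact CGLV2022_prop32_of_isOneAGeneric p Φ (kroneckerPow t M) (isOneAGeneric_kroneckerPow t hα N)

end Powers

end Literature.Computability.AlgebraicComplexity
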